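import HarnessLib
import Literature.AlgebraicGeometry.Resolution.QuadraticTransforms
import Mathlib.Algebra.Order.Archimedean.Real.Basic

/-!
# HugValuationCutChains — §1 of the decomp-res node «HugValuationCut» (lens-4 g14, HOME
decomp-res-lens-4/g14/HugValuationCut.lean
rev 1, sha256 52ca7cd9298143bb; critic row 91 CLEARED)

Tree file 1/4, route-independent, pure commutative algebra: HUG CHAINS in a field and their dominating valuation rings —
V1 Chevalley (a valuation ring dominating the whole chain exists), V4 value descent (a dominating ring with a UNIFORM VALUE GAP
is the union of the chain), `ℤ`-valued rings, V5 creep (a DENSE dominating valuation forces vanishing value gaps), V3 the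
coarsening dichotomy — PROVED, VERBATIM from the lens file.  The node record (lens header) is in `HugValuationCutClasses`
(file 2/4); kernels in `HugValuationCutKernels`; the up-links to 32260 BY NAME in `MaxContactCutHugValuationCut`.
[WRITER NOTE (decomp-res writer g5): imports/opens trimmed to what §1 uses (reviewer of p776326: route-independent, outside the
Theses cone); the option lines of the lens file are dropped (house style).]
(Sources: ZariskiSamuelII Ch. VI §§3–5; Abhyankar1956; CossartJannsenSaito2020.)
-/

noncomputable section

open IsLocalRing
open Literature.AlgebraicGeometry.Resolution

namespace Summit.ResolutionOfSingularities.ResolutionOfSingularities.Theorems.HugValuationCut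

/-! ## §1 Hug chains in a field and their dominating valuation rings (PROVED) -/

variable {K : Type} [Field K]

/-- A HUG CHAIN in the field `K`: a sequence of local subrings `R 0 ≤ R 1 ≤ ⋯` of `K` with `Frac (R 0) = K`, each
member a quadratic transform (tree `IsQuadraticTransform`, Cutkosky §2.1 / Abhyankar 1956) of the previous one.  The
shadow of a surface-hugging tower: `R i = 𝒪_{Σ_i, x_i}` read in the function field of the hugged surface germ `Σ`. -/
structure HugChain (K : Type) [Field K] : Type where
  /-- the local rings -/
  R : ℕ → Subring K
  /-- each is local -/
  isLocal : ∀ i, IsLocalRing (R i)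
  /-- each step is a quadratic transform -/
  qt : ∀ i, IsQuadraticTransform (R i) (R (i + 1))
  /-- `K` is the common fraction field -/
  frac : ∀ z : K, ∃ a ∈ R 0, ∃ b ∈ R 0, b ≠ 0 ∧ z = a / b

/-- `V` is `ℤ`-VALUED: it is the valuation ring of a valuation of `K` with values in `ℤ` (so `V = K` or `V` is a
discrete valuation ring of `K` of rank one). -/
def IsZValued (V : ValuationSubring K) : Prop :=
  ∃ ν : K → ℤ, (∀ x y : K, x ≠ 0 → y ≠ 0 → ν (x * y) = ν x + ν y) ∧ ∀ x : K, x ≠ 0 → (x ∈ V ↔ 0 ≤ ν x)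


namespace HugChain

variable (C : HugChain K)

attribute [instance] HugChain.isLocal

/-- (hug-chain bookkeeping) [folklore] -/
theorem le_succ (i : ℕ) : C.R i ≤ C.R (i + 1) := (C.qt i).dominates.1

/-- (hug-chain bookkeeping) [folklore] -/
theorem mono : Monotone C.R := monotone_nat_of_le_succ C.le_succ

/-- (hug-chain bookkeeping) [folklore] -/
theorem dominates_succ (i : ℕ) : SubringDominates (C.R i) (C.R (i + 1)) := (C.qt i).dominates

/-- (hug-chain bookkeeping) [folklore] -/
theorem dominates_of_le {i j : ℕ} (hij : i ≤ j) : SubringDominates (C.R i) (C.R j) := by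
  induction hij with
  | refl => exact SubringDominates.refl _
  | step _ ih => exact ih.trans (C.dominates_succ _)

/-- nonunits stay nonunits up the chain: `x ∈ R i`, `x⁻¹ ∈ R j` ⟹ `x⁻¹ ∈ R i`. [folklore] -/
theorem inv_mem_of_inv_mem {i j : ℕ} {x : K} (hx : x ∈ C.R i) (hinv : x⁻¹ ∈ C.R j) : x⁻¹ ∈ C.R i := by
  rcases le_total i j with hij | hji
  · exact (C.dominates_of_le hij).2 x hx hinv
  · exact C.mono hji hinv

/-- every element of `K` is a fraction over every `R i`. [folklore] -/
theorem frac' (i : ℕ) (z : K) : ∃ a ∈ C.R i, ∃ b ∈ C.R i, b ≠ 0 ∧ z = a / b := by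
  obtain ⟨a, ha, b, hb, hb0, rfl⟩ := C.frac z
  exact ⟨a, C.mono (Nat.zero_le i) ha, b, C.mono (Nat.zero_le i) hb, hb0, rfl⟩

/-- THE BLOW-UP RELATION of a quadratic transform: some non-zero nonunit `z ∈ R i` divides, inside `R (i+1)`, every
nonunit of `R i` (`R i [𝔪_i / z] ⊆ R (i+1)`). [folklore] -/
theorem exists_divider (i : ℕ) :
    ∃ z ∈ C.R i, z ≠ 0 ∧ z⁻¹ ∉ C.R i ∧ ∀ y ∈ C.R i, y⁻¹ ∉ C.R i → y / z ∈ C.R (i + 1) := by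
  obtain ⟨hloc, x, hxm, hx0, -, hbl, -, -⟩ := C.qt i
  have hx0' : (x : K) ≠ 0 := fun h => hx0 (Subtype.ext h)
  refine ⟨(x : K), x.2, hx0', ?_, fun y hy hyinv => ?_⟩
  · rcases (mem_maximalIdeal_iff_inv_not_mem x).mp hxm with h | h
    · exact absurd h hx0'
    · exact h
  · have hym : (⟨y, hy⟩ : C.R i) ∈ maximalIdeal (C.R i) :=
      (mem_maximalIdeal_iff_inv_not_mem _).mpr (Or.inr hyinv)
    exact hbl (div_mem_blowupRing (x : K) hym)

/-! ### V1 · Chevalley: a valuation ring dominating the whole chain exists -/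

/-- `V` DOMINATES the chain: every `R i ⊆ V` with `𝔪_V ∩ R i = 𝔪_i`. -/
def DominatedBy (V : ValuationSubring K) : Prop := ∀ i, SubringDominates (C.R i) V.toSubring

/-- **V1 (Chevalley).** Some valuation ring of `K` dominates every member of the chain. [folklore; Mathlib
`LocalSubring.exists_le_valuationSubring` applied to the union] [folklore] -/
theorem exists_dominatedBy : ∃ V : ValuationSubring K, C.DominatedBy V := by
  classical
  set U : Subring K := ⨆ i, C.R i with hU
  have hdir : Directed (· ≤ ·) C.R := C.mono.directed_le
  have hmemU : ∀ x, x ∈ U ↔ ∃ i, x ∈ C.R i := fun x => Subring.mem_iSup_of_directed hdir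
  have hRU : ∀ i, C.R i ≤ U := fun i => le_iSup C.R i
  have hinvU : ∀ i x, x ∈ C.R i → x⁻¹ ∈ U → x⁻¹ ∈ C.R i := by
    intro i x hx hxU
    obtain ⟨j, hj⟩ := (hmemU _).mp hxU
    exact C.inv_mem_of_inv_mem hx hj
  haveI hUloc : IsLocalRing U := by
    refine IsLocalRing.of_nonunits_add ?_
    intro a b ha hb
    rw [mem_nonunits_iff] at ha hb ⊢
    intro hab
    obtain ⟨hab0, habinv⟩ := (isUnit_subring_iff_inv_mem _).mp hab
    obtain ⟨i, hi⟩ := (hmemU _).mp a.2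
    obtain ⟨j, hj⟩ := (hmemU _).mp b.2
    set l := max i j
    have hal : (a : K) ∈ C.R l := C.mono (le_max_left i j) hi
    have hbl : (b : K) ∈ C.R l := C.mono (le_max_right i j) hj
    have habl : ((a : K) + b)⁻¹ ∈ C.R l := hinvU l _ ((C.R l).add_mem hal hbl) habinv
    -- in the local ring `R l`, `a + b` is a unit, so `a` or `b` is a unit there, hence in `U`
    have hu : IsUnit (⟨(a : K) + b, (C.R l).add_mem hal hbl⟩ : C.R l) :=
      (isUnit_subring_iff_inv_mem _).mpr ⟨hab0, habl⟩
    have hsum : (⟨(a : K) + b, (C.R l).add_mem hal hbl⟩ : C.R l) = ⟨a, hal⟩ + ⟨b, hbl⟩ := rfl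
    rw [hsum] at hu
    rcases IsLocalRing.isUnit_or_isUnit_of_isUnit_add hu with hua | hub
    · obtain ⟨h0, hinv⟩ := (isUnit_subring_iff_inv_mem _).mp hua
      exact ha ((isUnit_subring_iff_inv_mem _).mpr ⟨h0, hRU l hinv⟩)
    · obtain ⟨h0, hinv⟩ := (isUnit_subring_iff_inv_mem _).mp hub
      exact hb ((isUnit_subring_iff_inv_mem _).mpr ⟨h0, hRU l hinv⟩)
  obtain ⟨V, hV⟩ := (LocalSubring.mk U).exists_le_valuationSubring
  haveI : IsLocalRing V.toSubring := V.toLocalSubring.isLocalRing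
  have hUV : SubringDominates U V.toSubring := (subringDominates_iff U V.toSubring).mpr hV
  refine ⟨V, fun i => ⟨(hRU i).trans hUV.1, fun x hx hxV => hinvU i x hx (hUV.2 x (hRU i hx) hxV)⟩⟩

/-! ### V4 · value descent: a dominating valuation ring with a UNIFORM VALUE GAP is the union of the chain -/

/-- **V4 (value descent).**  Let `v : K → ℝ` be additive on products of non-zero elements and cut out `V`
(`x ∈ V ↔ 0 ≤ v x` for `x ≠ 0`), `V` dominating the chain.  If every non-zero nonunit of every `R i` has value
`≥ ε > 0`, then `V = ⋃ R i`: write `f = a/b` over `R i`; if `b` is a nonunit so is `a = f b`, divide both by the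
divider `z` of `R i` (value `≥ ε`) and continue in `R (i+1)` with `v b` lowered by `ε`. [folklore] -/
theorem mem_iUnion_of_gap {V : ValuationSubring K} (hV : C.DominatedBy V) (v : K → ℝ)
    (hmul : ∀ x y : K, x ≠ 0 → y ≠ 0 → v (x * y) = v x + v y)
    (hcut : ∀ x : K, x ≠ 0 → (x ∈ V ↔ 0 ≤ v x)) {ε : ℝ} (hε : 0 < ε)
    (hgap : ∀ i, ∀ z ∈ C.R i, z ≠ 0 → z⁻¹ ∉ C.R i → ε ≤ v z) :
    ∀ f ∈ V, ∃ i, f ∈ C.R i := by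
  -- induction on `n` with `v b < n ε`
  have key : ∀ n : ℕ, ∀ i (a b : K), a ∈ C.R i → b ∈ C.R i → b ≠ 0 → v b < n * ε → a / b ∈ V →
      ∃ j, a / b ∈ C.R j := by
    intro n
    induction n with
    | zero =>
      intro i a b _ hb hb0 hvb _
      have : 0 ≤ v b := (hcut b hb0).mp ((hV i).1 hb)
      simp at hvb
      linarith
    | succ n ih =>
      intro i a b ha hb hb0 hvb hf
      by_cases hbinv : b⁻¹ ∈ C.R i
      · exact ⟨i, by rw [div_eq_mul_inv]; exact (C.R i).mul_mem ha hbinv⟩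
      by_cases ha0 : a = 0
      · exact ⟨i, by rw [ha0, zero_div]; exact (C.R i).zero_mem⟩
      -- `a` is a nonunit too: else `b⁻¹ = (a/b)⁻¹ … `; precisely `b⁻¹ = a⁻¹ * (a / b)` hmm: `b⁻¹ = (a/b) * a⁻¹`? no:
      -- `(a / b) * a⁻¹ = b⁻¹`.
      have hainv : a⁻¹ ∉ C.R i := by
        intro hainv
        have hbV : b⁻¹ ∈ V := by
          have : (a / b) * a⁻¹ = b⁻¹ := by field_simp
          rw [← this]
          exact mul_mem hf ((hV i).1 hainv)
        exact hbinv ((hV i).2 b hb hbV)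
      obtain ⟨z, hz, hz0, hzinv, hdiv⟩ := C.exists_divider i
      have ha' : a / z ∈ C.R (i + 1) := hdiv a ha hainv
      have hb' : b / z ∈ C.R (i + 1) := hdiv b hb hbinv
      have hb'0 : b / z ≠ 0 := div_ne_zero hb0 hz0
      have hεz : ε ≤ v z := hgap i z hz hz0 hzinv
      have hvb' : v (b / z) < n * ε := by
        have h1 : v b = v (b / z) + v z := by
          have : b / z * z = b := div_mul_cancel₀ b hz0
          rw [← hmul (b / z) z hb'0 hz0, this]
        push_cast at hvb
        linarith
      have heq : a / b = (a / z) / (b / z) := by field_simp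
      obtain ⟨j, hj⟩ := ih (i + 1) (a / z) (b / z) ha' hb' hb'0 hvb' (heq ▸ hf)
      exact ⟨j, heq ▸ hj⟩
  intro f hf
  obtain ⟨a, ha, b, hb, hb0, rfl⟩ := C.frac f
  obtain ⟨n, hn⟩ := exists_nat_gt (v b / ε)
  have hvb : v b < n * ε := by
    rw [div_lt_iff₀ hε] at hn
    linarith
  exact key n 0 a b ha hb hb0 hvb hf

/-! ### discrete valuation rings: `ℤ`-valued -/

/-- **V4 for `ℤ`-valued valuation rings**: a `ℤ`-valued valuation ring dominating a hug chain is the union of the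
chain. [folklore; cf. Abhyankar 1956 Lemma 12 for regular `R 0`] [folklore] -/
theorem mem_iUnion_of_isZValued {V : ValuationSubring K} (hV : C.DominatedBy V) (hZ : IsZValued V) :
    ∀ f ∈ V, ∃ i, f ∈ C.R i := by
  obtain ⟨ν, hmul, hcut⟩ := hZ
  have h1 : ν 1 = 0 := by
    have := hmul 1 1 one_ne_zero one_ne_zero
    rw [one_mul] at this
    linarith
  refine C.mem_iUnion_of_gap hV (fun x => (ν x : ℝ)) (fun x y hx hy => by exact_mod_cast hmul x y hx hy)
    (fun x hx => by rw [hcut x hx]; exact_mod_cast Iff.rfl) one_pos (fun i z hz hz0 hzinv => ?_)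
  -- `z⁻¹ ∉ R i` and domination give `z⁻¹ ∉ V`, so `ν z⁻¹ < 0`, so `ν z ≥ 1`
  have hzV : z⁻¹ ∉ V := fun h => hzinv ((hV i).2 z hz h)
  have hneg : ¬ 0 ≤ ν z⁻¹ := fun h => hzV ((hcut z⁻¹ (inv_ne_zero hz0)).mpr h)
  have hsum : ν z + ν z⁻¹ = 0 := by
    rw [← hmul z z⁻¹ hz0 (inv_ne_zero hz0), mul_inv_cancel₀ hz0, h1]
  have : (1 : ℤ) ≤ ν z := by omega
  simpa using (show (1 : ℝ) ≤ (ν z : ℝ) by exact_mod_cast this)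

/-! ### V5 · creep: a DENSE dominating valuation forces vanishing value gaps -/

/-- **V5 (creep).**  If the real valuation `v` cutting out the dominating `V` takes arbitrarily small positive values
on `V` (its value group is not discrete), then the minimal values of the maximal ideals `𝔪_i` CREEP TO ZERO: for every
`ε > 0` some `R i` has a non-zero nonunit of value `< ε`. [folklore] -/
theorem creep {V : ValuationSubring K} (hV : C.DominatedBy V) (v : K → ℝ)
    (hmul : ∀ x y : K, x ≠ 0 → y ≠ 0 → v (x * y) = v x + v y)
    (hcut : ∀ x : K, x ≠ 0 → (x ∈ V ↔ 0 ≤ v x))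
    (hdense : ∀ ε : ℝ, 0 < ε → ∃ g ∈ V, g ≠ 0 ∧ 0 < v g ∧ v g < ε) :
    ∀ ε : ℝ, 0 < ε → ∃ i, ∃ z ∈ C.R i, z ≠ 0 ∧ z⁻¹ ∉ C.R i ∧ v z < ε := by
  intro ε hε
  by_contra hne
  push Not at hne
  have hgap : ∀ i, ∀ z ∈ C.R i, z ≠ 0 → z⁻¹ ∉ C.R i → ε ≤ v z := fun i z hz hz0 hzi => hne i z hz hz0 hzi
  obtain ⟨g, hgV, hg0, hgpos, hgε⟩ := hdense ε hε
  obtain ⟨i, hgi⟩ := C.mem_iUnion_of_gap hV v hmul hcut hε hgap g hgV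
  -- `v g > 0` ⟹ `g⁻¹ ∉ V` ⟹ `g⁻¹ ∉ R i` ⟹ gap
  have h1 : v 1 = 0 := by
    have := hmul 1 1 one_ne_zero one_ne_zero
    rw [one_mul] at this
    linarith
  have hginvV : g⁻¹ ∉ V := by
    intro h
    have h0 : 0 ≤ v g⁻¹ := (hcut _ (inv_ne_zero hg0)).mp h
    have hsum : v g + v g⁻¹ = 0 := by rw [← hmul g g⁻¹ hg0 (inv_ne_zero hg0), mul_inv_cancel₀ hg0, h1]
    linarith
  have hginv : g⁻¹ ∉ C.R i := fun h => hginvV ((hV i).1 h)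
  have := hgap i g hgi hg0 hginv
  linarith

/-! ### V3 · coarsening dichotomy: a non-dominating coarsening of a dominating valuation ring is a hugged curve -/

/-- A COMPATIBLE CHAIN OF HEIGHT-ONE PRIMES of the hug chain, set-theoretically: a subset `Q ⊆ K` cutting a prime
ideal `Q ∩ R i` out of EVERY `R i` (the same `Q`, so the primes are compatible under contraction), containing a
non-zero element of `R 0` (the primes are non-zero), and missing some nonunit of some `R i₀` (the primes are not
maximal from `i₀` on, nonunits persisting up the chain).  Geometrically: an integral curve germ on the hugged surface
through `x_{i₀}` whose strict transforms pass through every later `x_i`.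
(«height one» is meant for the intended two-dimensional regular local rings of a surface-hugging tower; for a general hug
chain the clauses only say: a compatible non-zero, non-unit, eventually non-maximal prime in every member.) -/
def HasHeightOneChain : Prop :=
  ∃ Q : Set K, (0 : K) ∈ Q ∧ (∀ x ∈ Q, ∀ y ∈ Q, x + y ∈ Q) ∧ (∀ i, ∀ r ∈ C.R i, ∀ x ∈ Q, r * x ∈ Q) ∧
    (∀ i, ∀ x ∈ C.R i, ∀ y ∈ C.R i, x * y ∈ Q → x ∈ Q ∨ y ∈ Q) ∧ (1 : K) ∉ Q ∧
    (∃ a ∈ C.R 0, a ≠ 0 ∧ a ∈ Q) ∧ ∃ i₀, ∃ x ∈ C.R i₀, x⁻¹ ∉ C.R i₀ ∧ x ∉ Q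

/-- **V3 (coarsening dichotomy).**  If `V` dominates the chain and a coarsening `V ≤ V' ≠ K` does NOT, then the
centres `𝔪_{V'} ∩ R i` form a compatible chain of non-zero, eventually non-maximal primes — a hugged curve.
Consequently (module docstring, (R)): in the class `¬ CurveHugging` every proper coarsening `≠ K` of a dominating
valuation ring dominates as well, divisorial rings never dominate (V4), and so every dominating ring has RANK ONE.
[folklore] -/
theorem hasHeightOneChain_of_coarsening {V V' : ValuationSubring K} (hV : C.DominatedBy V) (hle : V ≤ V')
    (htop : V' ≠ ⊤) (hnd : ¬ C.DominatedBy V') : C.HasHeightOneChain := by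
  classical
  set v := V'.valuation with hv
  have hRV' : ∀ i, ∀ x ∈ C.R i, x ∈ V' := fun i x hx => hle ((hV i).1 hx)
  have hle1 : ∀ i, ∀ x ∈ C.R i, v x ≤ 1 := fun i x hx => (V'.valuation_le_one_iff x).mpr (hRV' i x hx)
  refine ⟨{x | v x < 1}, ?_, ?_, ?_, ?_, ?_, ?_, ?_⟩
  · show v 0 < 1
    rw [map_zero]; exact zero_lt_one
  · intro x hx y hy
    exact Valuation.map_add_lt v hx hy
  · intro i r hr x hx
    show v (r * x) < 1
    calc v (r * x) = v r * v x := map_mul v r x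
      _ ≤ 1 * v x := mul_le_mul_left (hle1 i r hr) _
      _ = v x := one_mul _
      _ < 1 := hx
  · intro i x hx y hy hxy
    by_contra hne
    push Not at hne
    obtain ⟨hx1, hy1⟩ := hne
    have hx1' : v x = 1 := le_antisymm (hle1 i x hx) (not_lt.mp hx1)
    have hy1' : v y = 1 := le_antisymm (hle1 i y hy) (not_lt.mp hy1)
    have hprod : v (x * y) = 1 := by rw [map_mul, hx1', hy1', one_mul]
    have hxy' : v (x * y) < 1 := hxy
    rw [hprod] at hxy'
    exact lt_irrefl _ hxy'
  · show ¬ v 1 < 1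
    rw [map_one]; exact lt_irrefl 1
  · -- `V' ≠ K`: pick `f ∉ V'`; then `f⁻¹ ∈ 𝔪_{V'}`, `f⁻¹ = a / b` over `R 0`, and `a = f⁻¹ b` has value `< 1`
    have hf : ∃ f : K, f ∉ V' := by
      by_contra h
      push Not at h
      exact htop (ValuationSubring.ext (A := V') (B := ⊤) fun x => ⟨fun _ => ValuationSubring.mem_top x, fun _ => h x⟩)
    obtain ⟨f, hf⟩ := hf
    have hf0 : f ≠ 0 := fun h => hf (h ▸ V'.zero_mem)
    have hfinv : v f⁻¹ < 1 :=
      (v.one_lt_val_iff hf0).mp (not_le.mp fun h => hf ((V'.valuation_le_one_iff f).mp h))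
    obtain ⟨a, ha, b, hb, hb0, hab⟩ := C.frac f⁻¹
    have ha_eq : a = f⁻¹ * b := by rw [hab, div_mul_cancel₀ a hb0]
    refine ⟨a, ha, ?_, ?_⟩
    · rw [ha_eq]; exact mul_ne_zero (inv_ne_zero hf0) hb0
    · show v a < 1
      rw [ha_eq, map_mul]
      calc v f⁻¹ * v b ≤ v f⁻¹ * 1 := mul_le_mul_right (hle1 0 b hb) _
        _ = v f⁻¹ := mul_one _
        _ < 1 := hfinv
  · by_contra hall
    push Not at hall
    apply hnd
    intro i
    refine ⟨fun x hx => hRV' i x hx, fun x hx hxV' => ?_⟩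
    by_contra hxi
    have hx0 : x ≠ 0 := by
      rintro rfl
      exact hxi (by rw [inv_zero]; exact (C.R i).zero_mem)
    have hge : ¬ v x < 1 := by
      have h1 : v x⁻¹ ≤ 1 := (V'.valuation_le_one_iff _).mpr hxV'
      exact not_lt.mpr ((v.one_le_val_iff hx0).mpr h1)
    exact hge (hall i x hx hxi)

/-- In the class without hugged curves, domination is INHERITED BY COARSENINGS. [folklore] -/
theorem dominatedBy_of_le {V V' : ValuationSubring K} (hV : C.DominatedBy V) (hle : V ≤ V') (htop : V' ≠ ⊤)
    (hnc : ¬ C.HasHeightOneChain) : C.DominatedBy V' := by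
  by_contra hnd
  exact hnc (C.hasHeightOneChain_of_coarsening hV hle htop hnd)

/-- (R, Lean half) In the class without hugged curves, NO PROPER COARSENING `≠ K` of a dominating valuation ring is
`ℤ`-valued: it would dominate (V3), hence be the union of the chain (V4), hence lie inside `V`.  With Abhyankar's
inequality (docstring (R)) this makes every dominating ring RANK ONE. [folklore] -/
theorem not_isZValued_of_lt {V V' : ValuationSubring K} (hV : C.DominatedBy V) (hle : V ≤ V') (hne : V ≠ V')
    (htop : V' ≠ ⊤) (hnc : ¬ C.HasHeightOneChain) : ¬ IsZValued V' := by
  intro hZ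
  have hV' : C.DominatedBy V' := C.dominatedBy_of_le hV hle htop hnc
  have hsub : V' ≤ V := fun f hf => by
    obtain ⟨i, hi⟩ := C.mem_iUnion_of_isZValued hV' hZ f hf
    exact (hV i).1 hi
  exact hne (le_antisymm hle hsub)

end HugChain

end Summit.ResolutionOfSingularities.ResolutionOfSingularities.Theorems.HugValuationCut

end
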